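import Summits.BirchSwinnertonDyer.BirchSwinnertonDyer.Theorems.PrintCf2SplitBadEisensteinTwoDivisibilitiesHalfDescentClass
import Summits.BirchSwinnertonDyer.BirchSwinnertonDyer.Theorems.SchneiderFreeAdditiveX3PoitouTateSelmerDualityHolds
import Summits.BirchSwinnertonDyer.BirchSwinnertonDyer.Theorems.SchneiderFreeAdditiveX3PoitouTateShaDualityHolds
import HarnessLib

/-!
# Crux `PrintCf2.SplitBadTwoRankOneOfFacts` (item 20368), line `eisenstein_two_bdp_line` v9.3 (skeleton f51e1c5b17674c15):
# the cite-level stub `stub_prints_two` holds from THREE named facts — its two Poitou–Tate conjuncts are THEOREMS of the tree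

Cell `bsd-print-cf2`, seat `bsd-line-cf2-p1-w4` g2 (EXTRA WIDTH seat on crux stmt-BirchSwinnertonDyer-20368; lead `bsd-line-cf2-p1` g7,
FINAL). `--supports stmt-BirchSwinnertonDyer-20368` (helper). Theses-free; THEOREMS ONLY (0 definitions, 0 named facts, 0 `sorry`).
BSD is proved for no curve by any of this; no summit statement is proved by this seat.

The registered stub `stub_prints_two` of the line of record is the conjunction of FIVE named published inputs:
`ToricPublishedInputs` (item 20389), Liu–Zhang–Zhang 2018 Thm 1.5.1 ∧ 1.5.3 at an additive prime
(`LiuZhangZhang2018.thm151_thm153_modularCurve_heegnerVector_additive`), Poitou–Tate duality for Selmer structures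
(`∀ K, poitouTate_selmerStructure_duality K`), Poitou–Tate duality of `Ш¹(K, M^D)` and `Ш²(K, M)` (`∀ K, poitouTate_sha_tateDual K`) and
Milne 1972 §1 Thm. 1 in the any-model form (`Milne1972.bsdQuotient_baseChange_quadratic_anyModel`, item 24149). The two Poitou–Tate
conjuncts are KERNEL THEOREMS for every number field `K : Type` — cell bsd-schneider's
`SchneiderFreeAdditiveX3.PoitouTateReduction.poitouTate_selmerStructure_duality_holds` (door-c4 g18, Milne *ADT* I Thm. 4.10 (b) with
Cor. 2.3, Thm. 2.6, Howard Thm. 2.1.11) and `SchneiderFreeAdditiveX3.PoitouTateReduction.poitouTate_sha_tateDual_holds` (door-c4 g19,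
Milne *ADT* I Thm. 4.10 (a)) — so the stub's body follows from the THREE remaining facts. For the next LEAD: re-cut `stub_prints_two`
to the three-conjunct text `h3` below and feed the v9.3 consumers through `prints_two_of_toric_lzz_milne` (one line); the skeleton's
`controlZero_two_of_fin hPT hPT2 …` takes `fun K _ _ ↦ …poitouTate_selmerStructure_duality_holds K` / `poitouTate_sha_tateDual_forall` directly.

* `poitouTate_sha_tateDual_forall` — conjunct 4 in the stub's binder shape (`∀ (K : Type) [Field K] [NumberField K], …`), from the tree
  theorem; conjunct 3 in that shape is ALREADY landed as `SchneiderFreeAdditiveX3.ControlDischarged.pt_selmer_forall`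
  (`Theorems/SchneiderFreeAdditiveX3EndStateControlDischarged.lean`) and is inlined below (no restatement).
* `prints_two_of_toric_lzz_milne (h3) : <body of stub_prints_two VERBATIM>`.

References: [MilneADT2006] Ch. I Thm. 4.10, Cor. 2.3, Thm. 2.6, Lemma 4.13; [Howard2004HeegnerKolyvagin] Thm. 2.1.11;
[LiuZhangZhang2018] Thm 1.5.1, Thm 1.5.3; [Milne1972ArithmeticAV] §1 Thm. 1.
-/

set_option autoImplicit false

-- D-0017 layout: summit = sub-problem, so `Summit.BirchSwinnertonDyer.BirchSwinnertonDyer.…` is the mandated namespace of Theorems files.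
set_option linter.dupNamespace false

namespace Summit.BirchSwinnertonDyer.BirchSwinnertonDyer.Theorems.PrintCf2.EisensteinTwo

open Literature.NumberTheory.EllipticCurves Literature.NumberTheory.EllipticCurves.LiuZhangZhang2018
  Literature.NumberTheory.GaloisCohomology
  Summit.BirchSwinnertonDyer.BirchSwinnertonDyer.Theses.UniversalToricDescent

/-- **Poitou–Tate duality of `Ш¹(K, M^D)` and `Ш²(K, M)` at EVERY number field**, in the binder shape of conjunct 4 of
`stub_prints_two` (and of the socket `hPT2` of `controlZero_two_of_fin`): the tree theorem
`SchneiderFreeAdditiveX3.PoitouTateReduction.poitouTate_sha_tateDual_holds`.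
[cite: MilneADT2006, Ch. I, Thm. 4.10 (a) (proof, p. 58), Lemma 4.13] [cite: Tate1963DualityICM, Thm. 3.1] -/
theorem poitouTate_sha_tateDual_forall :
    ∀ (K : Type) [Field K] [NumberField K], poitouTate_sha_tateDual K :=
  fun K _ _ ↦ SchneiderFreeAdditiveX3.PoitouTateReduction.poitouTate_sha_tateDual_holds K

/-- **`stub_prints_two` from THREE named facts.** The body of the registered cite-level stub `stub_prints_two` of line
`eisenstein_two_bdp_line` v9.3 (five conjuncts, VERBATIM) follows from the three-conjunct bundle `h3` — the toric published inputs
(item 20389), Liu–Zhang–Zhang 2018 Thm 1.5.1 ∧ 1.5.3 at an additive prime, Milne 1972 §1 Thm. 1 (any model, item 24149) —, the two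
Poitou–Tate conjuncts being theorems of the tree. CONDITIONAL on `h3` (three statement-only named facts); closes nothing by itself.
[cite: LiuZhangZhang2018, Thm 1.5.1 and Thm 1.5.3 (Duke Math. J. 167 pp. 748–749)] [cite: Milne1972ArithmeticAV, §1 Thm. 1 (p. 182)]
[cite: MilneADT2006, Ch. I, Thm. 4.10] -/
theorem prints_two_of_toric_lzz_milne
    (h3 : ToricPublishedInputs ∧ LiuZhangZhang2018.thm151_thm153_modularCurve_heegnerVector_additive ∧
      Milne1972.bsdQuotient_baseChange_quadratic_anyModel) :
    (ToricPublishedInputs ∧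
      LiuZhangZhang2018.thm151_thm153_modularCurve_heegnerVector_additive ∧
      (∀ (K : Type) [Field K] [NumberField K], poitouTate_selmerStructure_duality K) ∧
      (∀ (K : Type) [Field K] [NumberField K], poitouTate_sha_tateDual K) ∧
      Milne1972.bsdQuotient_baseChange_quadratic_anyModel) :=
  ⟨h3.1, h3.2.1, fun K _ _ ↦ SchneiderFreeAdditiveX3.PoitouTateReduction.poitouTate_selmerStructure_duality_holds K,
    poitouTate_sha_tateDual_forall, h3.2.2⟩

end Summit.BirchSwinnertonDyer.BirchSwinnertonDyer.Theorems.PrintCf2.EisensteinTwo
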